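import Literature.AlgebraicGeometry.Motives.FaltingsECCardFactsProofs
import Literature.NumberTheory.EllipticCurves.IsogenyDeterminantProofs
import Literature.NumberTheory.EllipticCurves.FrobeniusDegreeProofs
import HarnessLib

/-!
# Tate's isogeny theorem for elliptic curves over finite fields — inputs reduced to Tate's Main Theorem and *AEC* Cor. III.6.3

Sibling file of `Literature.AlgebraicGeometry.Motives.FaltingsEC` (D-0014: the named fact
`Literature.AlgebraicGeometry.Motives.isIsogenous_iff_card_point_eq` is left untouched) continuing
`Literature.AlgebraicGeometry.Motives.FaltingsECCardFactsProofs`. There the fact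
`isIsogenous_iff_card_point_eq W W'` — Tate, Invent. Math. 2 (1966), Thm. 1 for elliptic curves;
Silverman, *AEC*, Exercise 5.4: *`E ~ E'` over `k` finite iff `#E(k) = #E'(k)`* — was reduced to
Tate's Main Theorem and, for each curve, *AEC* Prop. III.8.1 (Weil pairing), **Prop. III.8.6**
(`det ψ_ℓ = deg ψ`) and **Thm. III.4.10(a)** (`#ker ψ = deg_s ψ`). Three of these inputs are now
dispensed with:

* Thm. III.4.10(a) is a theorem of the tree (`Isogeny.card_ker_eq_finSepDegree_holds`,
  `Literature.NumberTheory.EllipticCurves.IsogenyDegreeKernelProofs`);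
* Prop. III.8.6 follows from **Cor. III.6.3** (`deg` is a quadratic form on `End_K(E)`: the
  named fact `WeierstrassCurve.degHom_isQuadraticForm W W` of `IsogenyDegree`; positive
  definiteness and `deg 0 = 0` are the tree's theorems `degHom_pos_holds`, `degHom_zero`) by
  `Literature.NumberTheory.EllipticCurves.IsogenyDeterminantProofs`
  (`Isogeny.det_tateModule_map_eq_deg_of_isQuadraticForm`), together with the tower law
  `deg(ψ ∘ φ) = deg ψ · deg φ` proved there;
* Prop. III.8.1 (the Weil pairing, used only for `det(φ_ℓ) = q`) is replaced by Prop. II.2.11(c)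
  (`deg φ = q` for the Frobenius `φ`), which is a theorem of the tree
  (`frobeniusIsogeny_deg_eq_card_holds`, `Literature.NumberTheory.EllipticCurves.FrobeniusDegreeProofs`).

Results:

* `Literature.AlgebraicGeometry.Motives.isIsogenous_iff_card_point_eq_of_isQuadraticForm` (one prime `ℓ ≠ char k`) and
  `…_of_isQuadraticForm_forall`: `isIsogenous_iff_card_point_eq W W'` from Tate's Main Theorem
  (`mem_span_range_tateModule_map_of_equivariant_of_finite W W' ℓ`), the Weil pairings
  (`exists_weilPairing`, Prop. III.8.1, for `det(φ_ℓ) = q`) and Cor. III.6.3 for `E` and `E'`;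
* `Literature.AlgebraicGeometry.Motives.isIsogenous_iff_card_point_eq_of_isQuadraticForm_of_deg` and `…_of_deg_forall`: the
  same with the Weil pairing replaced by Prop. II.2.11(c) (`deg φ = q` for the Frobenius `φ`, the
  named fact `frobeniusIsogeny_deg_eq_card`) — Silverman's own inputs for Thm. V.2.3.1, with
  Prop. III.8.6 now read through Cor. III.6.3;
* `Literature.AlgebraicGeometry.Motives.isIsogenous_iff_card_point_eq_of_tate_of_isQuadraticForm` and `…_forall`: the same
  with Prop. II.2.11(c) supplied by the tree's theorem `frobeniusIsogeny_deg_eq_card_holds`.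

So the remaining unproved inputs of `isIsogenous_iff_card_point_eq` in the tree are **Tate's Main
Theorem** (`mem_span_range_tateModule_map_of_equivariant_of_finite`, Tate 1966) and
**Cor. III.6.3** (`degHom_isQuadraticForm`, for `E` and for `E'`).

## References

* [Tate1966Endomorphisms] J. Tate, *Endomorphisms of abelian varieties over finite fields*,
  Invent. Math. 2 (1966), 134–144, Main Theorem and §3 Thm. 1.
* [SilvermanAEC2009] J. H. Silverman, *The Arithmetic of Elliptic Curves*, 2nd ed., GTM 106:
  Prop. II.2.11(c), Thm. III.4.10(a), Cor. III.5.5, Cor. III.6.3, Prop. III.8.1, Prop. III.8.6,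
  Thm. V.2.3.1 (PDF pp. 129–131), Exercise 5.4 (PDF p. 139).

## Design

`noncomputable section`, `open scoped Classical`, one universe `u`; nothing is defined.
-/

noncomputable section

open scoped Classical

universe u

namespace Literature.AlgebraicGeometry.Motives

open WeierstrassCurve

variable {K : Type u} [Field K] {W W' : WeierstrassCurve K} {ℓ : ℕ} [Fact ℓ.Prime]

/-- **Tate's isogeny theorem in point-count form, from Tate's Main Theorem, the Weil pairing and
*AEC* Cor. III.6.3** (one prime `ℓ ≠ char k`): `isIsogenous_iff_card_point_eq W W'` follows from
`mem_span_range_tateModule_map_of_equivariant_of_finite W W' ℓ` (Tate 1966, Main Theorem), the Weil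
pairings on `E[ℓ^n]`, `E'[ℓ^n]` (`hW`, `hW'`: Prop. III.8.1, giving `det(φ_ℓ) = q`) and
`degHom_isQuadraticForm` for `E` and `E'` (`h63`, `h63'`: Cor. III.6.3, giving Prop. III.8.6 by
`Isogeny.det_tateModule_map_eq_deg_of_isQuadraticForm`, hence `tr(φ_ℓ) = q + 1 - #E(k)`), via
`isIsogenous_iff_card_point_eq_of_frobenius_facts`.
[cite: Tate1966Endomorphisms, Main Theorem and Thm. 1] [cite: SilvermanAEC2009, Exercise 5.4 with Thm. V.2.3.1, Cor. III.6.3, Prop. III.8.1] -/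
theorem isIsogenous_iff_card_point_eq_of_isQuadraticForm (hℓ : (ℓ : K) ≠ 0)
    (hT : mem_span_range_tateModule_map_of_equivariant_of_finite W W' ℓ)
    (hW : ∀ n : ℕ, W.exists_weilPairing (ℓ ^ (n + 1)))
    (hW' : ∀ n : ℕ, W'.exists_weilPairing (ℓ ^ (n + 1)))
    (h63 : degHom_isQuadraticForm W W) (h63' : degHom_isQuadraticForm W' W') :
    isIsogenous_iff_card_point_eq W W' :=
  isIsogenous_iff_card_point_eq_of_frobenius_facts hℓ hT
    (trace_galoisRepTate_frobenius_of_isQuadraticForm W ℓ h63 hW)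
    (det_galoisRepTate_frobenius_of_exists_weilPairing' W ℓ hW)
    (trace_galoisRepTate_frobenius_of_isQuadraticForm W' ℓ h63' hW')
    (det_galoisRepTate_frobenius_of_exists_weilPairing' W' ℓ hW')

/-- **The same at all primes** (a prime `ℓ ∈ {2, 3}` with `ℓ ≠ char k` exists,
`exists_prime_natCast_ne_zero`): `isIsogenous_iff_card_point_eq W W'` from Tate's Main Theorem at
every prime, the Weil pairings on `E[m]`, `E'[m]` for all `m`, and Cor. III.6.3 for `E`, `E'`.
[cite: Tate1966Endomorphisms, Main Theorem and Thm. 1] [cite: SilvermanAEC2009, Exercise 5.4 with Thm. V.2.3.1, Cor. III.6.3, Prop. III.8.1] -/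
theorem isIsogenous_iff_card_point_eq_of_isQuadraticForm_forall
    (hT : ∀ (ℓ : ℕ) [Fact ℓ.Prime], mem_span_range_tateModule_map_of_equivariant_of_finite W W' ℓ)
    (hW : ∀ m : ℕ, W.exists_weilPairing m) (hW' : ∀ m : ℕ, W'.exists_weilPairing m)
    (h63 : degHom_isQuadraticForm W W) (h63' : degHom_isQuadraticForm W' W') :
    isIsogenous_iff_card_point_eq W W' := by
  intro _ _ _
  obtain ⟨l, hl, hlK⟩ := exists_prime_natCast_ne_zero K
  haveI : Fact l.Prime := ⟨hl⟩
  exact isIsogenous_iff_card_point_eq_of_isQuadraticForm hlK (hT l) (fun n ↦ hW _) (fun n ↦ hW' _)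
    h63 h63'

/-- **Tate's isogeny theorem in point-count form, from Tate's Main Theorem, *AEC* Cor. III.6.3 and
Prop. II.2.11(c)** (one prime `ℓ ≠ char k`, no Weil pairing): the Frobenius facts are supplied by
`det_galoisRepTate_frobenius_of_isQuadraticForm_of_deg` and
`trace_galoisRepTate_frobenius_of_isQuadraticForm_of_deg` (`IsogenyDeterminantProofs`) from
`degHom_isQuadraticForm` (`h63`, `h63'`) and `frobeniusIsogeny_deg_eq_card` (`hdeg`, `hdeg'`:
`deg φ = q`). [cite: Tate1966Endomorphisms, Main Theorem and Thm. 1] [cite: SilvermanAEC2009, Exercise 5.4 with Thm. V.2.3.1, Cor. III.6.3, Prop. II.2.11(c)] -/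
theorem isIsogenous_iff_card_point_eq_of_isQuadraticForm_of_deg (hℓ : (ℓ : K) ≠ 0)
    (hT : mem_span_range_tateModule_map_of_equivariant_of_finite W W' ℓ)
    (h63 : degHom_isQuadraticForm W W) (h63' : degHom_isQuadraticForm W' W')
    (hdeg : W.frobeniusIsogeny_deg_eq_card) (hdeg' : W'.frobeniusIsogeny_deg_eq_card) :
    isIsogenous_iff_card_point_eq W W' :=
  isIsogenous_iff_card_point_eq_of_frobenius_facts hℓ hT
    (trace_galoisRepTate_frobenius_of_isQuadraticForm_of_deg W ℓ h63 hdeg)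
    (det_galoisRepTate_frobenius_of_isQuadraticForm_of_deg W ℓ h63 hdeg)
    (trace_galoisRepTate_frobenius_of_isQuadraticForm_of_deg W' ℓ h63' hdeg')
    (det_galoisRepTate_frobenius_of_isQuadraticForm_of_deg W' ℓ h63' hdeg')

/-- **The same at all primes** (no Weil pairing): `isIsogenous_iff_card_point_eq W W'` from Tate's
Main Theorem at every prime, Cor. III.6.3 and Prop. II.2.11(c) for `E` and `E'`.
[cite: Tate1966Endomorphisms, Main Theorem and Thm. 1] [cite: SilvermanAEC2009, Exercise 5.4 with Thm. V.2.3.1, Cor. III.6.3, Prop. II.2.11(c)] -/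
theorem isIsogenous_iff_card_point_eq_of_isQuadraticForm_of_deg_forall
    (hT : ∀ (ℓ : ℕ) [Fact ℓ.Prime], mem_span_range_tateModule_map_of_equivariant_of_finite W W' ℓ)
    (h63 : degHom_isQuadraticForm W W) (h63' : degHom_isQuadraticForm W' W')
    (hdeg : W.frobeniusIsogeny_deg_eq_card) (hdeg' : W'.frobeniusIsogeny_deg_eq_card) :
    isIsogenous_iff_card_point_eq W W' := by
  intro _ _ _
  obtain ⟨l, hl, hlK⟩ := exists_prime_natCast_ne_zero K
  haveI : Fact l.Prime := ⟨hl⟩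
  exact isIsogenous_iff_card_point_eq_of_isQuadraticForm_of_deg hlK (hT l) h63 h63' hdeg hdeg'

/-- **Tate's isogeny theorem in point-count form from Tate's Main Theorem and *AEC* Cor. III.6.3
alone** (one prime `ℓ ≠ char k`): `isIsogenous_iff_card_point_eq W W'` — *`E ~ E'` over the
finite field `k` iff `#E(k) = #E'(k)`* (Tate 1966, Thm. 1; Silverman, *AEC*, Exercise 5.4) —
follows from `mem_span_range_tateModule_map_of_equivariant_of_finite W W' ℓ` (Tate's Main Theorem)
and `degHom_isQuadraticForm` for `E` and `E'` (Cor. III.6.3); every other input of the printed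
proof (Thm. V.2.3.1 via Prop. III.8.6, Prop. II.2.11(c), Thm. III.4.10(a), Cor. III.5.5) is a
theorem of the tree. [cite: Tate1966Endomorphisms, Main Theorem and Thm. 1] [cite: SilvermanAEC2009, Exercise 5.4 with Thm. V.2.3.1 and Cor. III.6.3] -/
theorem isIsogenous_iff_card_point_eq_of_tate_of_isQuadraticForm (hℓ : (ℓ : K) ≠ 0)
    (hT : mem_span_range_tateModule_map_of_equivariant_of_finite W W' ℓ)
    (h63 : degHom_isQuadraticForm W W) (h63' : degHom_isQuadraticForm W' W') :
    isIsogenous_iff_card_point_eq W W' :=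
  isIsogenous_iff_card_point_eq_of_isQuadraticForm_of_deg hℓ hT h63 h63'
    (frobeniusIsogeny_deg_eq_card_holds W) (frobeniusIsogeny_deg_eq_card_holds W')

/-- **The same at all primes**: `isIsogenous_iff_card_point_eq W W'` from Tate's Main Theorem at
every prime and Cor. III.6.3 for `E` and `E'` (a prime `ℓ ∈ {2, 3}` with `ℓ ≠ char k` exists).
This is the shape of the eventual `isIsogenous_iff_card_point_eq_holds`.
[cite: Tate1966Endomorphisms, Main Theorem and Thm. 1] [cite: SilvermanAEC2009, Exercise 5.4 with Thm. V.2.3.1 and Cor. III.6.3] -/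
theorem isIsogenous_iff_card_point_eq_of_tate_of_isQuadraticForm_forall
    (hT : ∀ (ℓ : ℕ) [Fact ℓ.Prime], mem_span_range_tateModule_map_of_equivariant_of_finite W W' ℓ)
    (h63 : degHom_isQuadraticForm W W) (h63' : degHom_isQuadraticForm W' W') :
    isIsogenous_iff_card_point_eq W W' := by
  intro _ _ _
  obtain ⟨l, hl, hlK⟩ := exists_prime_natCast_ne_zero K
  haveI : Fact l.Prime := ⟨hl⟩
  exact isIsogenous_iff_card_point_eq_of_tate_of_isQuadraticForm hlK (hT l) h63 h63'

end Literature.AlgebraicGeometry.Motives
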